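import Summits.QuantumFields.BalabanUV.Beta.CompositeCorrectorBordered
import Summits.QuantumFields.BalabanUV.Beta.CompositeCorrectorFormsGeneric
import Summits.QuantumFields.BalabanUV.Beta.CompositeVertexWardRootedPacked
import Summits.QuantumFields.BalabanUV.Beta.GAN24.SymLinKernelExpansion
import Summits.QuantumFields.BalabanUV.Beta.CompositeCorrectorKernelSym

/-!
# `BalabanUV.Beta.CompositeCorrectorBorderedSym` — binder row D1 ∕ (C1), K-U3d-sym (L-k4b): **THE FOUR ENTRIES OF THE CONGRUENCE-BORDERED HESSIAN `Φ̂ˢ_mᵀ ∘ bhK (L^m) ∘ Φ̂ˢ_m`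
# AND THE DICTIONARY** — K-U3d L4b `CompositeCorrectorBordered` re-typed at `phiKSym := kerOf (corrPhiSym …)`: the termwise actions, the four entries (`trK_phiKSym_bhK_phiKSym_*`: the
# slot rows of the bordered operator are the (0.4) composite rows `compLinAvgSymAt`), and the DICTIONARY `compLinAvgSymAt … δ_f = (L^{d+1})^m · compLinKer (symLinKerAt ∘ toSite ∘ r) …`
# (the (0.4) composite rows ARE the composite linear kernel over the (0.4) bricks) — so `RelInvCompositeSym.bhKcompSym`'s border is read by name.

WHAT ([folklore] bookkeeping; no `def`; nothing cited; 0 sorry).  (II) CONTROLS: the ROOTED entries are the tree's (K-U3d L4b) with the rooted composite row `compLinAvgAt r L m`.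

HONEST FRAMING (cell charter, verbatim): «discharging BetaPertH makes Balaban's UV stability UNCONDITIONAL — a real
constructive-QFT result; it is NOT the continuum limit and NOT the Clay problem.»
HONEST DEPENDENCY: continuum YM on T⁴ ⇐ BetaPertH ∧ nine spine estimates (0/9 proved); BetaPertH ⇐ (D1) ∧ (D4) ∧ CAP+tail;
G-an2-4 gates asym, D1 and NE2/3/4.
ABSOLUTE RULE (cell, verbatim): «No internally-minted statement may enter as a cited fact. Every hypothesis is either kernel-proved in this
package or a verbatim quotation of a PUBLISHED theorem with page reference. The manuscript(s) under audit are NOT citable for their own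
disputed steps — they are the thing under adjudication; programme-internal (2001/route/tribunal) claims are never citable.»
Row D1 ∕ (C1) OWNER an2 (b2b-balaban-beta-an2) gen 92, 2026-08-31.  No existing file touched.  STAGED ONLY (FILING PLAN FP-L F-L4); NOT proposed before the operator∕director line.
NOTHING of Bałaban's asserted, valued or discharged; 0 estimates; 0∕4 row-D1 binders; ROOT M‴ p325680 ∕ P5c ∕ D6 untouched; NOT (C1), NOT (T-ID), NOT D1, NEVER «G-an2-4 closed», NOT BetaPertH, NOT continuum, NOT Clay.
-/


namespace Summit.QuantumFields.BalabanUV.Beta.CompositeCorrectorBorderedSym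

open Finset
open scoped BigOperators
open Literature.Probability.LatticeModels (Torus.proj)
open Literature.MathematicalPhysics.QuantumFieldTheory
open Literature.MathematicalPhysics.QuantumFieldTheory.Balaban1983to89
open Literature.MathematicalPhysics.QuantumFieldTheory.Balaban1983to89.Beta
open ExpKernelCalculus (MKer comp)
open AffineAveraging (Form0 Form1 Form2 box toSite unitVec dz curv curvAdj contourSum)
open AffineReproduction (contourSumAdj)
open LatticeForm (quo)
open KKTFluctuationKernel (delta1 delta1_apply)
open OneStepResolventKernel (Fib)
open Summit.QuantumFields.BalabanUV.Beta.TameKernelCalculus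
open Summit.QuantumFields.BalabanUV.Beta.AxialDressingRooted (cube tsum_point tsum_point')
open Summit.QuantumFields.BalabanUV.Beta.BorderedHessian (bhK bhK_inl_inl bhK_inl_inr bhK_inr_inl bhK_inr_inr bhK_inl_inl_eq fcol mcol fcol_apply
  mcol_apply comp_bhK_inl comp_bhK_inr tsum_bhK_inl_inl tsum_bhK_inr_inl curvAdj_curv_delta1_symm contourSum_delta1_eq_contourSumAdj
  contourSumAdj_zero)
open Summit.QuantumFields.BalabanUV.Beta.CompositeAveragingCoarseExact (compLinAvgAt)
open Summit.QuantumFields.BalabanUV.Beta.CompositeAveragingCoarseExactGeneric (compLinAvgSymAt corrPhiSym contourSum_corrPhiSym curv_corrPhiSym)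
open Summit.QuantumFields.BalabanUV.Beta.CompositeCorrectorKernel (kerOf indR phiK indR_apply)
open Summit.QuantumFields.BalabanUV.Beta.CompositeCorrectorKernelSym (phiKSym phiKSym_inl_inl phiKSym_inl_inr phiKSym_inr_inl phiKSym_inr_inr)
open Summit.QuantumFields.BalabanUV.Beta.CompositeCorrectorBordered (indR_eq_delta1 trK_phiK_bhK_phiK_inl_inl trK_phiK_bhK_phiK_inr_inl
  trK_phiK_bhK_phiK_inl_inr trK_phiK_bhK_phiK_inr_inr)

noncomputable section

variable {d : ℕ}

/-! ## §1 Termwise actions (no summability, no re-association) — `CompositeCorrectorBordered` §1 verbatim at `Φ̂ˢ` -/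

section Bordered

variable (r : ℕ → (Fin (d + 1) → ℕ)) (L m : ℕ)

/-- [folklore] LEFT ACTION OF `Φ̂ˢ_mᵀ`, FIELD ROWS: `(Φ̂ˢᵀ ∘ K)(x,z)_{inl α, b} = Σ'_y Σ_l (Φˢ_m δ_{(α,x)})_l(y) · K(y,z)_{inl l, b}`. -/
theorem comp_trK_phiKSym_inl_left (K : MKer (d + 1) (Fib d)) (x z : Fin (d + 1) → ℤ) (α : Fin (d + 1)) (b : Fib d) :
    comp (trK (phiKSym r L m)) K x z (Sum.inl α) b = ∑' y, ∑ l : Fin (d + 1), corrPhiSym r L m (indR α x) l y * K y z (Sum.inl l) b := by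
  unfold ExpKernelCalculus.comp
  refine tsum_congr fun y => ?_
  rw [Fintype.sum_sum_type]
  simp only [trK_apply, phiKSym_inl_inl, phiKSym_inr_inl, zero_mul, Finset.sum_const_zero, add_zero]

/-- [folklore] LEFT ACTION OF `Φ̂ˢ_mᵀ`, MULTIPLIER ROWS: the row is picked. -/
theorem comp_trK_phiKSym_inr_left (K : MKer (d + 1) (Fib d)) (x z : Fin (d + 1) → ℤ) (μ : Fin (d + 1)) (b : Fib d) :
    comp (trK (phiKSym r L m)) K x z (Sum.inr μ) b = K x z (Sum.inr μ) b := by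
  unfold ExpKernelCalculus.comp
  have e : ∀ y, ∑ f : Fib d, trK (phiKSym r L m) x y (Sum.inr μ) f * K y z f b = if x = y then K y z (Sum.inr μ) b else 0 := by
    intro y
    rw [Fintype.sum_sum_type]
    simp only [trK_apply, phiKSym_inl_inr, zero_mul, Finset.sum_const_zero, zero_add, phiKSym_inr_inr]
    rw [Finset.sum_eq_single μ (fun μ' _ hμ' => by rw [if_neg (fun h => hμ' h.2), zero_mul]) (fun h => absurd (Finset.mem_univ μ) h)]
    by_cases hy : x = y
    · rw [if_pos ⟨hy.symm, rfl⟩, one_mul, if_pos hy]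
    · rw [if_neg (fun h => hy h.1.symm), zero_mul, if_neg hy]
  simp_rw [e]
  exact tsum_point x _

/-- [folklore] MULTIPLIER COLUMNS OF `K ∘ Φ̂ˢ_m`: the column is picked. -/
theorem comp_phiKSym_inr_right (K : MKer (d + 1) (Fib d)) (x z : Fin (d + 1) → ℤ) (a : Fib d) (μ : Fin (d + 1)) :
    comp K (phiKSym r L m) x z a (Sum.inr μ) = K x z a (Sum.inr μ) := by
  unfold ExpKernelCalculus.comp
  have e : ∀ y, ∑ f : Fib d, K x y a f * phiKSym r L m y z f (Sum.inr μ) = if y = z then K x y a (Sum.inr μ) else 0 := by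
    intro y
    rw [Fintype.sum_sum_type]
    simp only [phiKSym_inl_inr, mul_zero, Finset.sum_const_zero, zero_add, phiKSym_inr_inr]
    rw [Finset.sum_eq_single μ (fun μ' _ hμ' => by rw [if_neg (fun h => hμ' h.2), mul_zero]) (fun h => absurd (Finset.mem_univ μ) h)]
    by_cases hy : y = z
    · rw [if_pos ⟨hy, rfl⟩, mul_one, if_pos hy]
    · rw [if_neg (fun h => hy h.1), mul_zero, if_neg hy]
  simp_rw [e]
  rw [tsum_point' z (fun y => K x y a (Sum.inr μ))]

/-- [folklore] Field–field entry of `Φ̂ˢ_mᵀ ∘ bhK`: UNCHANGED (matrix symmetry of `d*d` + PART 126 `curv_corrPhiSym`). -/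
theorem comp_trK_phiKSym_bhK_inl_inl (x z : Fin (d + 1) → ℤ) (α β : Fin (d + 1)) :
    comp (trK (phiKSym r L m)) (bhK (L ^ m)) x z (Sum.inl α) (Sum.inl β) = bhK (L ^ m) x z (Sum.inl α) (Sum.inl β) := by
  rw [comp_trK_phiKSym_inl_left]
  have e : ∀ y, ∑ l : Fin (d + 1), corrPhiSym r L m (indR α x) l y * bhK (L ^ m) y z (Sum.inl l) (Sum.inl β) =
      ∑ l : Fin (d + 1), bhK (L ^ m) z y (Sum.inl β) (Sum.inl l) * phiKSym r L m y x (Sum.inl l) (Sum.inl α) := by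
    intro y
    refine Finset.sum_congr rfl fun l _ => ?_
    rw [bhK_inl_inl_eq, curvAdj_curv_delta1_symm, ← bhK_inl_inl_eq (L ^ m) z y β l, phiKSym_inl_inl, mul_comm]
  simp_rw [e]
  have hf : fcol (phiKSym r L m) x (Sum.inl α) = corrPhiSym r L m (indR α x) := by
    funext l y; rw [fcol_apply, phiKSym_inl_inl]
  rw [tsum_bhK_inl_inl, hf, curv_corrPhiSym, indR_eq_delta1, curvAdj_curv_delta1_symm, ← bhK_inl_inl_eq]

/-- [folklore] The field columns of `(Φ̂ˢ_mᵀ ∘ bhK) ∘ Φ̂ˢ_m` are those of `bhK ∘ Φ̂ˢ_m` (termwise, no re-association). -/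
theorem comp_comp_trK_phiKSym_bhK_phiKSym_inl (x z : Fin (d + 1) → ℤ) (a : Fib d) (β : Fin (d + 1)) :
    comp (comp (trK (phiKSym r L m)) (bhK (L ^ m))) (phiKSym r L m) x z a (Sum.inl β) = comp (bhK (L ^ m)) (phiKSym r L m) x z a (Sum.inl β) := by
  unfold ExpKernelCalculus.comp
  refine tsum_congr fun y => ?_
  rw [Fintype.sum_sum_type, Fintype.sum_sum_type]
  simp only [phiKSym_inr_inl, mul_zero, Finset.sum_const_zero, add_zero]
  refine Finset.sum_congr rfl fun l _ => ?_
  rcases a with α | μ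
  · show comp (trK (phiKSym r L m)) (bhK (L ^ m)) x y (Sum.inl α) (Sum.inl l) * _ = _
    rw [comp_trK_phiKSym_bhK_inl_inl r L m]
  · show comp (trK (phiKSym r L m)) (bhK (L ^ m)) x y (Sum.inr μ) (Sum.inl l) * _ = _
    rw [comp_trK_phiKSym_inr_left]

variable {L} (hL : 0 < L)
include hL

/-- [folklore] Field–field entry of `bhK ∘ Φ̂ˢ_m`: UNCHANGED (PART 126 `curv_corrPhiSym`: `d*d` is flat against the (0.4) corrector). -/
theorem comp_bhK_phiKSym_inl_inl (x z : Fin (d + 1) → ℤ) (κ β : Fin (d + 1)) :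
    comp (bhK (L ^ m)) (phiKSym r L m) x z (Sum.inl κ) (Sum.inl β) = curvAdj (curv (delta1 β z)) κ x := by
  haveI : NeZero (L ^ m) := ⟨(pow_pos hL m).ne'⟩
  have hf : fcol (phiKSym r L m) z (Sum.inl β) = corrPhiSym r L m (indR β z) := by
    funext l y; rw [fcol_apply, phiKSym_inl_inl]
  have hm : mcol (L ^ m) (phiKSym r L m) z (Sum.inl β) = 0 := by
    funext l y'; rw [mcol_apply, phiKSym_inr_inl]; rfl
  rw [comp_bhK_inl, hf, hm, curv_corrPhiSym, indR_eq_delta1, contourSumAdj_zero, Pi.zero_apply, Pi.zero_apply, sub_zero]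

/-- [folklore] **Multiplier–field entry of `bhK ∘ Φ̂ˢ_m`: THE RE-LINEARISED BORDER IS THE (0.4) COMPOSITE ROW** `[proj x = 0]·(compLinAvgSymAt (toSite ∘ r) L m δ_{(β,z)})_κ(x∕n)`
(PART 126 `contourSum_corrPhiSym`). -/
theorem comp_bhK_phiKSym_inr_inl (x z : Fin (d + 1) → ℤ) (κ β : Fin (d + 1)) :
    comp (bhK (L ^ m)) (phiKSym r L m) x z (Sum.inr κ) (Sum.inl β) =
      if Torus.proj (L ^ m) x = 0 then compLinAvgSymAt (fun k => toSite (r k)) L m (delta1 β z) κ (quo (L ^ m) x) else 0 := by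
  haveI : NeZero (L ^ m) := ⟨(pow_pos hL m).ne'⟩
  have hf : fcol (phiKSym r L m) z (Sum.inl β) = corrPhiSym r L m (indR β z) := by
    funext l y; rw [fcol_apply, phiKSym_inl_inl]
  rw [comp_bhK_inr, hf, contourSum_corrPhiSym r hL, indR_eq_delta1]

/-- [folklore] Field–multiplier entry of `Φ̂ˢ_mᵀ ∘ bhK`: minus the transposed (0.4) composite row at a coarse `z` (duality `𝒬 ↔ 𝒬ᵀ`). -/
theorem comp_trK_phiKSym_bhK_inl_inr (x z : Fin (d + 1) → ℤ) (α μ : Fin (d + 1)) :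
    comp (trK (phiKSym r L m)) (bhK (L ^ m)) x z (Sum.inl α) (Sum.inr μ) =
      if Torus.proj (L ^ m) z = 0 then -(compLinAvgSymAt (fun k => toSite (r k)) L m (delta1 α x) μ (quo (L ^ m) z)) else 0 := by
  haveI : NeZero (L ^ m) := ⟨(pow_pos hL m).ne'⟩
  rw [comp_trK_phiKSym_inl_left]
  by_cases hz : Torus.proj (L ^ m) z = 0
  · have e : ∀ y, ∑ l : Fin (d + 1), corrPhiSym r L m (indR α x) l y * bhK (L ^ m) y z (Sum.inl l) (Sum.inr μ) =
        -(∑ l : Fin (d + 1), bhK (L ^ m) z y (Sum.inr μ) (Sum.inl l) * phiKSym r L m y x (Sum.inl l) (Sum.inl α)) := by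
      intro y
      rw [← Finset.sum_neg_distrib]
      refine Finset.sum_congr rfl fun l _ => ?_
      rw [bhK_inl_inr, if_pos hz, bhK_inr_inl, if_pos hz, contourSum_delta1_eq_contourSumAdj, phiKSym_inl_inl]
      ring
    simp_rw [e]
    have hf : fcol (phiKSym r L m) x (Sum.inl α) = corrPhiSym r L m (indR α x) := by
      funext l y; rw [fcol_apply, phiKSym_inl_inl]
    rw [tsum_neg, tsum_bhK_inr_inl (L ^ m) hz, hf, contourSum_corrPhiSym r hL, indR_eq_delta1, if_pos hz]
  · have e : ∀ y, ∑ l : Fin (d + 1), corrPhiSym r L m (indR α x) l y * bhK (L ^ m) y z (Sum.inl l) (Sum.inr μ) = 0 := by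
      intro y
      refine Finset.sum_eq_zero fun l _ => ?_
      rw [bhK_inl_inr, if_neg hz, mul_zero]
    simp_rw [e]
    rw [tsum_zero, if_neg hz]

/-! ## §2 THE FOUR ENTRIES OF `Φ̂ˢ_mᵀ ∘ bhK (L^m) ∘ Φ̂ˢ_m` (= XREAD-RS's `bhKcompSym r L m`, the operator of `relInv_compositeSym` ∕ `relInv_ANs'_sym`) -/

/-- [folklore] **FIELD–FIELD ENTRY: UNCHANGED** — the windowed matrix of `d*d`. -/
theorem trK_phiKSym_bhK_phiKSym_inl_inl (x z : Fin (d + 1) → ℤ) (κ β : Fin (d + 1)) :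
    comp (comp (trK (phiKSym r L m)) (bhK (L ^ m))) (phiKSym r L m) x z (Sum.inl κ) (Sum.inl β) = bhK (L ^ m) x z (Sum.inl κ) (Sum.inl β) := by
  rw [comp_comp_trK_phiKSym_bhK_phiKSym_inl r L m, comp_bhK_phiKSym_inl_inl r m hL, bhK_inl_inl_eq]

/-- [folklore] **MULTIPLIER–FIELD ENTRY: THE (0.4) COMPOSITE ROW** `[proj x = 0]·(compLinAvgSymAt (toSite ∘ r) L m δ_{(β,z)})_κ(x∕n)` — the straight row `𝒬_n` of `bhK`
becomes the m-fold (0.4)-SYMMETRISED composite linear averaging, same normalisation, multiplier legs at the coarse points.  THIS is the kernel-level face of «the congruence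
border's slot rows ARE the (0.4) composite rows». -/
theorem trK_phiKSym_bhK_phiKSym_inr_inl (x z : Fin (d + 1) → ℤ) (κ β : Fin (d + 1)) :
    comp (comp (trK (phiKSym r L m)) (bhK (L ^ m))) (phiKSym r L m) x z (Sum.inr κ) (Sum.inl β) =
      if Torus.proj (L ^ m) x = 0 then compLinAvgSymAt (fun k => toSite (r k)) L m (delta1 β z) κ (quo (L ^ m) x) else 0 := by
  rw [comp_comp_trK_phiKSym_bhK_phiKSym_inl r L m, comp_bhK_phiKSym_inr_inl r m hL]

/-- [folklore] **FIELD–MULTIPLIER ENTRY: MINUS THE TRANSPOSED (0.4) COMPOSITE ROW** `−[proj z = 0]·(compLinAvgSymAt (toSite ∘ r) L m δ_{(α,x)})_μ(z∕n)`. -/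
theorem trK_phiKSym_bhK_phiKSym_inl_inr (x z : Fin (d + 1) → ℤ) (α μ : Fin (d + 1)) :
    comp (comp (trK (phiKSym r L m)) (bhK (L ^ m))) (phiKSym r L m) x z (Sum.inl α) (Sum.inr μ) =
      if Torus.proj (L ^ m) z = 0 then -(compLinAvgSymAt (fun k => toSite (r k)) L m (delta1 α x) μ (quo (L ^ m) z)) else 0 := by
  rw [comp_phiKSym_inr_right]
  exact comp_trK_phiKSym_bhK_inl_inr r m hL x z α μ

omit hL in
/-- [folklore] **MULTIPLIER–MULTIPLIER ENTRY: ZERO**. -/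
theorem trK_phiKSym_bhK_phiKSym_inr_inr (x z : Fin (d + 1) → ℤ) (μ₀ μ : Fin (d + 1)) :
    comp (comp (trK (phiKSym r L m)) (bhK (L ^ m))) (phiKSym r L m) x z (Sum.inr μ₀) (Sum.inr μ) = 0 := by
  rw [comp_phiKSym_inr_right, comp_trK_phiKSym_inr_left, bhK_inr_inr]

end Bordered

/-! ## §4 (v1.1) THE DICTIONARY: the (0.4) composite rows of the congruence border ARE the composite linear kernel over the (0.4) bricks -/

section Dictionary

open AveragingHessianKernels (Bond)
open AveragingHessianKernelsRooted (linKerAt)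
open Summit.QuantumFields.BalabanUV.Beta.SymAveragingHessianCounts (symLinKerAt symLinCountAt)
open Summit.QuantumFields.BalabanUV.Beta.LinearGaugeVH (nearBox)
open Summit.QuantumFields.BalabanUV.Beta.GAN24.SymLinKernelExpansion (symLinAvgAt_eq_sum_symLinCountAt)
open Summit.QuantumFields.BalabanUV.Beta.CompositeAveragingCoarseExactGeneric (compLinAvgSymAt_zero compLinAvgSymAt_succ avSym_apply)
open Summit.QuantumFields.BalabanUV.Beta.CompositeVertexKernelRec (offs compLinKer compLinKer_zero compLinKer_succ)
open Summit.QuantumFields.BalabanUV.Beta.CompositeVertexWardRooted (sum_offs_eq_sum_nearBox)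
open Summit.QuantumFields.BalabanUV.Beta.CompositeVertexWardRootedPacked (compLinAvgAt_delta1_eq_pow_mul_compLinKer)

variable {L : ℕ} {r : ℕ → Fin (d + 1) → ℕ}

/-- [folklore] **`compLinAvgSymAt (toSite ∘ r) L m δ_f = (L^{d+1})^m · compLinKer (symLinKerAt ∘ toSite ∘ r) L m f`** — the (0.4)-SYMMETRISED composite rows of
`bhKcompSym`'s border (§2 `trK_phiKSym_bhK_phiKSym_inr_inl`) are, bond by bond, an2's top-peeled composite linear kernel (`CompositeVertexKernelRec.compLinKer`) over the
(0.4)-symmetrised single bricks `symLinKerAt (toSite (r k)) L` — the record's brick list — in an1's normalisation (induction on `m`: `compLinAvgSymAt_succ`, `avSym_apply`,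
GAN24's bond-count expansion `symLinAvgAt_eq_sum_symLinCountAt`, `symLinKerAt = count ∕ ((d+1)!·L^{d+1})`, the window as `nearBox`, `compLinKer_succ`) — PART 105b's rooted
dictionary `compLinAvgAt_delta1_eq_pow_mul_compLinKer` with the two sym swaps. -/
theorem compLinAvgSymAt_delta1_eq_pow_mul_compLinKer (hL : 1 ≤ L) (hr : ∀ k, r k ∈ box (d + 1) L) :
    ∀ (m : ℕ) (f : Bond (d + 1)) (κ : Fin (d + 1)) (Y : Fin (d + 1) → ℤ),
      compLinAvgSymAt (fun k => toSite (r k)) L m (delta1 f.1 f.2) κ Y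
        = (((L : ℝ) ^ (d + 1)) ^ m) * compLinKer (fun k => symLinKerAt (toSite (r k)) L) L m f (κ, Y)
  | 0, f, κ, Y => by
    rw [compLinAvgSymAt_zero, compLinKer_zero, pow_zero, one_mul, delta1_apply]
    have e : (κ = f.1 ∧ Y = f.2) ↔ ((κ, Y) : Bond (d + 1)) = f :=
      ⟨fun ⟨h1, h2⟩ => Prod.ext h1 h2, fun h => ⟨congrArg Prod.fst h, congrArg Prod.snd h⟩⟩
    rw [if_congr e rfl rfl]
  | m + 1, f, κ, Y => by
    have hL' : (L : ℝ) ^ (d + 1) ≠ 0 := pow_ne_zero _ (by exact_mod_cast (show L ≠ 0 by omega))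
    have hd : ((Nat.factorial (d + 1) : ℕ) : ℝ) ≠ 0 := Nat.cast_ne_zero.mpr (Nat.factorial_ne_zero _)
    rw [compLinAvgSymAt_succ, avSym_apply, symLinAvgAt_eq_sum_symLinCountAt (hr m) _ κ Y, compLinKer_succ,
      ← sum_offs_eq_sum_nearBox Y (fun x => ∑ α : Fin (d + 1),
          (symLinCountAt (toSite (r m)) L κ Y (α, x) : ℝ) * compLinAvgSymAt (fun k => toSite (r k)) L m (delta1 f.1 f.2) α x),
      Finset.mul_sum, Finset.sum_comm, Finset.mul_sum]
    dsimp only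
    refine Finset.sum_congr rfl fun x _ => ?_
    rw [Finset.mul_sum, Finset.mul_sum]
    refine Finset.sum_congr rfl fun α _ => ?_
    rw [compLinAvgSymAt_delta1_eq_pow_mul_compLinKer hL hr m f α ((L : ℤ) • Y + x), symLinKerAt]
    field_simp
    ring

/-- (II) CONTROL [folklore]: the ROOTED dictionary is the tree's PART 105b. -/
example (hL : 1 ≤ L) (hr : ∀ k, r k ∈ box (d + 1) L) (m : ℕ) (f : Bond (d + 1)) (κ : Fin (d + 1)) (Y : Fin (d + 1) → ℤ) :
    compLinAvgAt r L m (delta1 f.1 f.2) κ Y = (((L : ℝ) ^ (d + 1)) ^ m) * compLinKer (fun k => linKerAt (toSite (r k)) L) L m f (κ, Y) :=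
  compLinAvgAt_delta1_eq_pow_mul_compLinKer hL hr m f κ Y

end Dictionary

/-! ## §3 (II) CONTROLS: the ROOTED entries are the tree's (K-U3d L4b), with the rooted composite row `compLinAvgAt r L m` -/

section Control

variable (r : ℕ → (Fin (d + 1) → ℕ)) {L : ℕ} (hL : 0 < L) (m : ℕ)

example (x z : Fin (d + 1) → ℤ) (κ β : Fin (d + 1)) :
    comp (comp (trK (phiK r L m)) (bhK (L ^ m))) (phiK r L m) x z (Sum.inr κ) (Sum.inl β) =
      if Torus.proj (L ^ m) x = 0 then compLinAvgAt r L m (delta1 β z) κ (quo (L ^ m) x) else 0 :=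
  trK_phiK_bhK_phiK_inr_inl r m hL x z κ β

example (x z : Fin (d + 1) → ℤ) (κ β : Fin (d + 1)) :
    comp (comp (trK (phiK r L m)) (bhK (L ^ m))) (phiK r L m) x z (Sum.inl κ) (Sum.inl β) = bhK (L ^ m) x z (Sum.inl κ) (Sum.inl β) :=
  trK_phiK_bhK_phiK_inl_inl r m hL x z κ β

end Control

end

end Summit.QuantumFields.BalabanUV.Beta.CompositeCorrectorBorderedSym
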